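import Literature.Barriers.CriticalPhenomena.ScaleCovarianceNotMoebius

/-!
# `RotationUpgradeFromTwoPoint` (item stmt-CriticalPhenomena-8367): decorating a limit on the coincident locus

Tool for the load-bearing analysis of hypothesis (H3) (normalisation off `NonCoincident`) of the crux
`Summit.CriticalPhenomena.Ising3DConformalLimit.Theses.GaussianScaleMixture.RotationUpgradeFromTwoPoint`
(standing crux disprover, D-0016, cycle 1): `decorate Δ S` changes a correlation family `S` ONLY at
order `3` and ONLY on coincident triples, adding `decor Δ x = ((x₂-x₀)₀)²/‖x₂-x₀‖² · ‖x₂-x₀‖^{-3Δ}`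
(translation invariant, homogeneous of degree `-3Δ`, cubic but not round). A pointwise scaling limit
(of any lattice family), non-degeneracy, translation invariance, scale covariance with `Δ` and the
two-point isotropy survive the decoration (`decorate_lim`, `decorate_nondeg`, `decorate_transl`,
`decorate_scale`, `decorate_iso`), rotation invariance does NOT (`decorate_not_rot`: the coincident
triple `(0,0,e₀)` versus its coordinate swap `(0,0,e₁)`, values `1` versus `0`). Used in
`Negative/LoadBearingHypotheses.lean` (`not_cruxWithoutNormalisation`).
-/

noncomputable section

namespace Summit.CriticalPhenomena.Ising3DConformalLimit.RotationUpgradeFromTwoPointNegative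

open Literature.Probability.LatticeModels Literature.Barriers.CriticalPhenomena
open Filter Set Function ScaleNotMoebius
open scoped Topology

variable {ρ : ℝ → ℝ} {Δ : ℝ} {S : CorrFamily 3}

open Classical in
/-- A decoration living on the COINCIDENT locus of order `3`: `0` at injective triples, and
`((x₂-x₀)₀)²/‖x₂-x₀‖² · ‖x₂-x₀‖^{-3Δ}` (translation invariant, degree `-3Δ`, cubic but not round)
otherwise. [folklore] -/
def decor (Δ : ℝ) (x : Fin 3 → (EuclideanSpace ℝ (Fin 3))) : ℝ :=
  if Function.Injective x then 0
  else ((x 2 - x 0) 0) ^ 2 / ‖x 2 - x 0‖ ^ 2 * twoPt (3 * Δ / 2) (x 0) (x 2)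

/-- `S` decorated at order `3` on the coincident locus. [folklore] -/
def decorate (Δ : ℝ) (S : CorrFamily 3) : CorrFamily 3 := fun n =>
  match n with
  | 0 => S 0
  | 1 => S 1
  | 2 => S 2
  | 3 => fun x => S 3 x + decor Δ x
  | (n + 4) => S (n + 4)

/-- The decoration vanishes at injective triples. [folklore] -/
theorem decor_of_injective (Δ : ℝ) {x : Fin 3 → (EuclideanSpace ℝ (Fin 3))} (hx : Function.Injective x) : decor Δ x = 0 := by
  rw [decor, if_pos hx]

/-- The decorated family agrees with `S` on non-coincident configurations. [folklore] -/
theorem decorate_eqOn (Δ : ℝ) (S : CorrFamily 3) (n : ℕ) :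
    Set.EqOn (decorate Δ S n) (S n) (NonCoincident 3 n) := by
  intro x hx
  match n, x, hx with
  | 0, _, _ => rfl
  | 1, _, _ => rfl
  | 2, _, _ => rfl
  | 3, x, hx =>
    show S 3 x + decor Δ x = S 3 x
    rw [decor_of_injective Δ ((mem_nonCoincident x).1 hx), add_zero]
  | (n + 4), _, _ => rfl

/-- Locally uniform convergence on a set only sees the limit function ON the set. [folklore] -/
theorem tendstoLocallyUniformlyOn_congr_limit {ι X : Type*} [TopologicalSpace X]
    {F : ι → X → ℝ} {f g : X → ℝ} {p : Filter ι} {s : Set X}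
    (hF : TendstoLocallyUniformlyOn F f p s) (hfg : Set.EqOn f g s) :
    TendstoLocallyUniformlyOn F g p s := by
  intro u hu x hx
  obtain ⟨t, ht, hFt⟩ := hF u hu x hx
  refine ⟨t ∩ s, inter_mem ht self_mem_nhdsWithin, ?_⟩
  filter_upwards [hFt] with n hn y hy
  rw [← hfg hy.2]
  exact hn y hy.1

/-- (H2) survives the decoration (it only constrains `S` on `NonCoincident`). [folklore] -/
theorem decorate_lim {G : LatticeCorrFamily 3} (Δ : ℝ) (hlim : HasPointwiseScalingLimit G ρ S) :
    HasPointwiseScalingLimit G ρ (decorate Δ S) := fun n =>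
  tendstoLocallyUniformlyOn_congr_limit (hlim n) (decorate_eqOn Δ S n).symm

/-- (H4) survives the decoration. [folklore] -/
theorem decorate_nondeg (Δ : ℝ) (hnd : IsNondegenerateTwoPoint S) :
    IsNondegenerateTwoPoint (decorate Δ S) := hnd

/-- The decoration is translation invariant. [folklore] -/
theorem decor_add (Δ : ℝ) (x : Fin 3 → (EuclideanSpace ℝ (Fin 3))) (v : (EuclideanSpace ℝ (Fin 3))) : decor Δ (fun i => x i + v) = decor Δ x := by
  have hinj := injective_comp_iff (add_left_injective v) x
  by_cases hx : Function.Injective x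
  · rw [decor_of_injective Δ (hinj.2 hx), decor_of_injective Δ hx]
  · rw [decor, if_neg (mt hinj.1 hx), decor, if_neg hx, twoPt_add]
    simp

/-- The decoration is homogeneous of degree `-3Δ`. [folklore] -/
theorem decor_smul (Δ : ℝ) {c : ℝ} (hc : 0 < c) (x : Fin 3 → (EuclideanSpace ℝ (Fin 3))) :
    decor Δ (fun i => c • x i) = c ^ (-((3 : ℕ) : ℝ) * Δ) * decor Δ x := by
  have hinj := injective_comp_iff (smul_right_injective _ hc.ne') x
  by_cases hx : Function.Injective x
  · rw [decor_of_injective Δ (hinj.2 hx), decor_of_injective Δ hx, mul_zero]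
  · rw [decor, if_neg (mt hinj.1 hx), decor, if_neg hx, twoPt_smul _ hc]
    have hexp : (-(2 * (3 * Δ / 2))) = -((3 : ℕ) : ℝ) * Δ := by push_cast; ring
    rw [hexp, ← smul_sub, norm_smul, Real.norm_eq_abs, abs_of_pos hc, PiLp.smul_apply, smul_eq_mul,
      mul_pow, mul_pow, mul_div_mul_left _ _ (pow_ne_zero 2 hc.ne')]
    ring

/-- (H5) survives the decoration. [folklore] -/
theorem decorate_transl (Δ : ℝ) (htr : IsTranslationInvariant S) :
    IsTranslationInvariant (decorate Δ S) := by
  intro n v x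
  match n, x with
  | 0, x => exact htr 0 v x
  | 1, x => exact htr 1 v x
  | 2, x => exact htr 2 v x
  | 3, x =>
    show S 3 (fun i => x i + v) + decor Δ (fun i => x i + v) = S 3 x + decor Δ x
    rw [htr 3 v x, decor_add]
  | (n + 4), x => exact htr (n + 4) v x

/-- (H6) survives the decoration. [folklore] -/
theorem decorate_scale (hsc : IsScaleCovariant Δ S) : IsScaleCovariant Δ (decorate Δ S) := by
  intro n c hc x
  match n, x with
  | 0, x => exact hsc 0 c hc x
  | 1, x => exact hsc 1 c hc x
  | 2, x => exact hsc 2 c hc x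
  | 3, x =>
    show S 3 (fun i => c • x i) + decor Δ (fun i => c • x i) = _ * (S 3 x + decor Δ x)
    rw [hsc 3 c hc x, decor_smul Δ hc, mul_add]
  | (n + 4), x => exact hsc (n + 4) c hc x

/-- (H7) survives the decoration (order `2` is untouched), given rotation invariance of `S`. [folklore] -/
theorem decorate_iso (Δ : ℝ) (hrot : IsRotationInvariant S) :
    ∀ (R : (EuclideanSpace ℝ (Fin 3)) ≃ₗᵢ[ℝ] (EuclideanSpace ℝ (Fin 3))) (x : EuclideanSpace ℝ (Fin 3)),
      x ≠ 0 → decorate Δ S 2 ![0, R x] = decorate Δ S 2 ![0, x] := by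
  intro R x _
  show S 2 ![0, R x] = S 2 ![0, x]
  have h := hrot 2 R ![0, x]
  have hcfg : (fun i => R ((![0, x] : Fin 2 → (EuclideanSpace ℝ (Fin 3))) i)) = ![0, R x] := by
    funext i; fin_cases i <;> simp
  rw [hcfg] at h
  exact h

/-- The coincident test triple `(0, 0, e₀)`. [folklore] -/
def coincidentTriple : Fin 3 → (EuclideanSpace ℝ (Fin 3)) := ![0, 0, axisUnit]

/-- The coordinate swap `x₀ ↔ x₁` (an element of `B₃ ⊂ O(3)`). [folklore] -/
def swap01 : (EuclideanSpace ℝ (Fin 3)) ≃ₗᵢ[ℝ] (EuclideanSpace ℝ (Fin 3)) := LinearIsometryEquiv.piLpCongrLeft 2 ℝ ℝ (Equiv.swap 0 1)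

/-- The test triple is coincident. [folklore] -/
theorem not_injective_coincidentTriple : ¬ Function.Injective coincidentTriple := by
  intro h
  have : coincidentTriple 0 = coincidentTriple 1 := by simp [coincidentTriple]
  exact absurd (h this) (by decide)

/-- The decoration at the test triple is `1`. [folklore] -/
theorem decor_coincidentTriple (Δ : ℝ) : decor Δ coincidentTriple = 1 := by
  rw [decor, if_neg not_injective_coincidentTriple]
  simp [coincidentTriple, twoPt, axisUnit]

/-- The decoration at the swapped test triple is `0`. [folklore] -/
theorem decor_swap_coincidentTriple (Δ : ℝ) :
    decor Δ (fun i => swap01 (coincidentTriple i)) = 0 := by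
  have hninj : ¬ Function.Injective (fun i => swap01 (coincidentTriple i)) :=
    mt (injective_comp_iff swap01.injective _).1 not_injective_coincidentTriple
  rw [decor, if_neg hninj]
  have h0 : (swap01 (coincidentTriple 2) - swap01 (coincidentTriple 0)) 0 = 0 := by
    rw [← map_sub]
    simp [swap01, coincidentTriple, axisUnit]
  rw [h0]
  simp

/-- **The decorated limit is not rotation invariant** (although `S` is). [folklore] -/
theorem decorate_not_rot (Δ : ℝ) (hrot : IsRotationInvariant S) : ¬ IsRotationInvariant (decorate Δ S) := by
  intro h
  have h3 := h 3 swap01 coincidentTriple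
  change S 3 (fun i => swap01 (coincidentTriple i)) + decor Δ (fun i => swap01 (coincidentTriple i)) =
    S 3 coincidentTriple + decor Δ coincidentTriple at h3
  rw [hrot 3 swap01 coincidentTriple, decor_swap_coincidentTriple, decor_coincidentTriple] at h3
  linarith

end Summit.CriticalPhenomena.Ising3DConformalLimit.RotationUpgradeFromTwoPointNegative

end
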